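import Summits.AnomalousDissipation.AnomalousDissipation.Theorems.WindLineWindyGalerkinSteadyZerothLawBaireBirthCoherent
import Summits.AnomalousDissipation.AnomalousDissipation.Theorems.WindLineWindyGalerkinSteadyZerothLawNondegenerateLoudOpen
import Summits.AnomalousDissipation.AnomalousDissipation.Theorems.WindLineWindyGalerkinSteadyZerothLawGenericLeafNondegeneracy

/-!
# `WindLine.WindyGalerkinSteadyZerothLaw` (stmt-AnomalousDissipation-11414): the birth of the heart BY CATEGORY (glue of line `registered`, rev 7)

Support file for the crux (lands `--supports stmt-AnomalousDissipation-11414`).  The line's transfer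
(`windyGalerkinSteadyZerothLaw_of_loudNondegenerateSteadyStates`, this namespace, p146525) reduces the crux X to the HEART: loud,
bounded, leaf-nondegenerate classical steady states of `NS_{ν_j}(f)` along `ν_j → 0⁺` for ONE smooth divergence-free mean-zero force.
Rev 5/6 (`…BaireBirth.lean`, p150591) obtained the heart from a DENSITY hypothesis A (loud parameters dense in a fixed non-empty open
set `U` of the Baire space `𝒜 ⊆ SymL2 (Fin 3)` of entire forces at every level) together with generic leaf-nondegeneracy B
(LANDED, p158084), openness O (LANDED, p151720) and the force dictionary D (LANDED, p149945).  This file replaces A by its CATEGORY form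

* (P) NON-MEAGRE LOUD STEADY FORCES: along some `ν_j → 0⁺`, with pinned momenta `m_j` and fixed budgets, the set of parameters `c ∈ 𝒜`
  whose force `F⟦c⟧ = SymL2.field (k ↦ e^{|k|²}) c` carries AT EVERY LEVEL a classical steady state with `∫u = m_j`, `∫|u|² < E`,
  `ε < ν_j‖∇u‖²` is NOT MEAGRE in `𝒜`,

and proves, sorry-free and with every hypothesis inline:

* `loudNondegenerateSteadyStates_of_nonMeagre` : P → B → D → HEART — B makes `⋂ⱼ interior G_j` residual (countably many open dense
  sets), a residual set meets every non-meagre set, and at a common point `c⋆` the level-`j` loud states are nondegenerate because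
  `c⋆ ∈ G_j`.  No openness and no Baire-space argument is needed: P is exactly the weakest hypothesis on the loud set under which B can be
  applied to it (a set meets every residual set iff it is non-meagre);
* `windyGalerkinSteadyZerothLaw_of_categoryBirth` : P → B → D → X BY NAME (through the landed transfer);
* `steadyZerothLaw_of_categoryBirth`, `coherentThesis_of_categoryBirth`, `anomalousDissipation_of_categoryBirth` : the same three
  statements close `CoherentStates.SteadyZerothLaw` (stmt-0219), `CoherentThesis` (stmt-0218) and the summit statement by name;
* `nonMeagreLoud_of_denseLoud` : A → B → O → P — the MONOTONICITY CERTIFICATE of the reshape (rev 7 asks no more than rev 6): by the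
  landed `denseRobustNondegenerateLoud_of_dense` the open nondegenerate-loud sets `N_j` are dense in `U`, the sets `N_j ∪ (closure U)ᶜ`
  are open dense in `𝒜`, and if `U ∩ ⋂ⱼ N_j` (a subset of P's loud set) were meagre, a residual set would miss the non-empty open `U`,
  contradicting the Baire property of `𝒜` (`baireSpace_admissible`, landed).

References: Foias–Temam, LNM 565 (1976) 24–28; CPAM 30 (1977) 149–164; Ann. SNS Pisa (4) 5 (1978) 29–63, Thm. 3.1–3.3; Saut–Temam, Comm.
PDE 4 (1979); Smale, Amer. J. Math. 87 (1965); Oxtoby, *Measure and Category*, Ch. 9; Simon, Ann. Math. 141 (1995) (Baire–Osgood transfer);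
Temam, *Navier–Stokes Equations* (1979) Ch. II.  Route file `Theses/WindLine.lean`; skeleton `Cruxes/WindyGalerkinSteadyZerothLaw/Lines/birth.lean` rev 7.
-/

noncomputable section

-- D-0017: single-problem summit ⇒ the duplicated namespace segment is by design.
set_option linter.dupNamespace false

open scoped InnerProductSpace Topology ComplexConjugate
open MeasureTheory Filter UnitAddTorus Set
open Literature.Analysis.FunctionSpaces Literature.Analysis.FunctionSpaces.Torus
open Literature.Analysis.FunctionSpaces.EuclideanSpace
open Literature.Analysis.FluidPDE Literature.Analysis.FluidPDE.Torus

namespace Summit.AnomalousDissipation.AnomalousDissipation.Theorems.WindLineWindyGalerkinSteadyZerothLaw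

/-- The flat three-torus (local notation). -/
local notation "𝕋³" => UnitAddTorus (Fin 3)
/-- Velocity values (local notation). -/
local notation "E³" => EuclideanSpace ℝ (Fin 3)
set_option quotPrecheck false in
/-- **The admissible parameter set** `𝒜 ⊆ SymL2 (Fin 3)`: conjugation-symmetric square-summable families with no mean mode and
transversal coefficients (local notation; used as the TYPE `↥𝒜` of parameters). -/
local notation "𝒜" => ({c : SymL2 (Fin 3) | c 0 = 0 ∧
  ∀ k : Fin 3 → ℤ, ∑ j : Fin 3, ((k j : ℤ) : ℂ) * c k j = 0} : Set (SymL2 (Fin 3)))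
/-- **The force of a parameter**: the real field with Fourier coefficients `e^{−|k|²} c k` (Gaussian-damped synthesis `SymL2.field`
at the weight `k ↦ e^{|k|²}`; local notation). -/
local notation "F⟦" c "⟧" => SymL2.field (fun k : Fin 3 → ℤ => Real.exp (freqNormSq k)) (c : SymL2 (Fin 3))

/-- **P ∧ B ∧ D ⇒ HEART (birth by category).**  B makes `O_j := interior G_j` open and dense for every level `j` (`G_j` = parameters
all of whose steady states of momentum `m_j` at viscosity `ν_j` are leaf-nondegenerate), so `⋂ⱼ O_j` is residual
(`residual_of_dense_open`, `countable_iInter_mem`); a residual set meets every non-meagre set — in particular the loud set of P — at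
some `c⋆`; the level-`j` loud bounded steady state of `F⟦c⋆⟧` is nondegenerate because `c⋆ ∈ G_j`, and D makes `F⟦c⋆⟧` smooth,
divergence free and mean zero.  Hypotheses inline = the registered stubs `stub_nonMeagreLoudSteadyForces` (open),
`stub_genericLeafNondegeneracy` (landed), `stub_forceDictionary` (landed) of `Cruxes/WindyGalerkinSteadyZerothLaw/Lines/birth.lean` rev 7. -/
theorem loudNondegenerateSteadyStates_of_nonMeagre
    (hP : ∃ (ν : ℕ → ℝ) (m : ℕ → E³) (E ε : ℝ), (∀ j, 0 < ν j) ∧ Tendsto ν atTop (𝓝 0) ∧ 0 < ε ∧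
      ¬ IsMeagre {c : 𝒜 | ∀ j, ∃ (u : 𝕋³ → E³) (p : 𝕋³ → ℝ),
          IsSteadyNSState (ν j) F⟦c⟧ u p ∧ ∫ x, u x = m j ∧
            ∫ x, ‖u x‖ ^ 2 < E ∧ ε < ν j * gradNormSq u})
    (hB : ∀ (ν : ℝ) (m : E³), 0 < ν →
      Dense (interior {c : 𝒜 | ∀ (u : 𝕋³ → E³) (p : 𝕋³ → ℝ),
        IsSteadyNSState ν F⟦c⟧ u p → ∫ x, u x = m → ¬ IsLinNSEigenvalue ν u 0}))
    (hD : ∀ c : 𝒜, IsSmooth F⟦c⟧ ∧ IsDivFree F⟦c⟧ ∧ HasZeroMean F⟦c⟧) :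
    ∃ f : 𝕋³ → E³, IsSmooth f ∧ IsDivFree f ∧ HasZeroMean f ∧
      ∃ (ν : ℕ → ℝ) (E ε : ℝ), (∀ j, 0 < ν j) ∧ Tendsto ν atTop (𝓝 0) ∧ 0 < ε ∧
        ∀ j, ∃ (u : 𝕋³ → E³) (p : 𝕋³ → ℝ),
          IsSteadyNSState (ν j) f u p ∧ ¬ IsLinNSEigenvalue (ν j) u 0 ∧
            ∫ x, ‖u x‖ ^ 2 < E ∧ ε < ν j * gradNormSq u := by
  obtain ⟨ν, m, E, ε, hν, hν0, hε, hL⟩ := hP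
  -- the residual set of parameters that are fully leaf-nondegenerate at every level
  set O : ℕ → Set 𝒜 := fun j => interior {c : 𝒜 | ∀ (u : 𝕋³ → E³) (p : 𝕋³ → ℝ),
    IsSteadyNSState (ν j) F⟦c⟧ u p → ∫ x, u x = m j → ¬ IsLinNSEigenvalue (ν j) u 0} with hO
  have hres : (⋂ j, O j) ∈ residual 𝒜 :=
    countable_iInter_mem.2 fun j => residual_of_dense_open isOpen_interior (hB (ν j) (m j) (hν j))
  -- a non-meagre set meets every residual set
  have hmeet : ({c : 𝒜 | ∀ j, ∃ (u : 𝕋³ → E³) (p : 𝕋³ → ℝ),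
      IsSteadyNSState (ν j) F⟦c⟧ u p ∧ ∫ x, u x = m j ∧
        ∫ x, ‖u x‖ ^ 2 < E ∧ ε < ν j * gradNormSq u} ∩ ⋂ j, O j).Nonempty := by
    by_contra h
    rw [not_nonempty_iff_eq_empty] at h
    apply hL
    rw [IsMeagre]
    refine Filter.mem_of_superset hres fun c hc hcL => ?_
    have : c ∈ (∅ : Set 𝒜) := h ▸ ⟨hcL, hc⟩
    exact this
  obtain ⟨c, hcL, hcO⟩ := hmeet
  obtain ⟨hs, hdf, hmz⟩ := hD c
  refine ⟨F⟦c⟧, hs, hdf, hmz, ν, E, ε, hν, hν0, hε, fun j => ?_⟩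
  obtain ⟨u, p, hst, hm, hE, hεu⟩ := hcL j
  have hcG := interior_subset (mem_iInter.1 hcO j)
  simp only [mem_setOf_eq] at hcG
  exact ⟨u, p, hst, hcG u p hst hm, hE, hεu⟩

/-- **THE CATEGORY BIRTH CLOSES THE CRUX BY NAME: P → B → D → X.**  Non-meagre loud steady forces, generic leaf-nondegeneracy and the
force dictionary give the heart (`loudNondegenerateSteadyStates_of_nonMeagre`), and the LANDED transfer
`windyGalerkinSteadyZerothLaw_of_loudNondegenerateSteadyStates` (Galerkin shadowing of leaf-nondegenerate steady states, strict room in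
the budgets) turns the heart into `WindLine.WindyGalerkinSteadyZerothLaw`. -/
theorem windyGalerkinSteadyZerothLaw_of_categoryBirth :
    (∃ (ν : ℕ → ℝ) (m : ℕ → E³) (E ε : ℝ), (∀ j, 0 < ν j) ∧ Tendsto ν atTop (𝓝 0) ∧ 0 < ε ∧
      ¬ IsMeagre {c : 𝒜 | ∀ j, ∃ (u : 𝕋³ → E³) (p : 𝕋³ → ℝ),
          IsSteadyNSState (ν j) F⟦c⟧ u p ∧ ∫ x, u x = m j ∧
            ∫ x, ‖u x‖ ^ 2 < E ∧ ε < ν j * gradNormSq u}) →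
    (∀ (ν : ℝ) (m : E³), 0 < ν →
      Dense (interior {c : 𝒜 | ∀ (u : 𝕋³ → E³) (p : 𝕋³ → ℝ),
        IsSteadyNSState ν F⟦c⟧ u p → ∫ x, u x = m → ¬ IsLinNSEigenvalue ν u 0})) →
    (∀ c : 𝒜, IsSmooth F⟦c⟧ ∧ IsDivFree F⟦c⟧ ∧ HasZeroMean F⟦c⟧) →
    Summit.AnomalousDissipation.AnomalousDissipation.Theses.WindLine.WindyGalerkinSteadyZerothLaw :=
  fun hP hB hD =>
    windyGalerkinSteadyZerothLaw_of_loudNondegenerateSteadyStates (loudNondegenerateSteadyStates_of_nonMeagre hP hB hD)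

/-- **P → B → D → `CoherentStates.SteadyZerothLaw` (stmt-AnomalousDissipation-0219) BY NAME.**  The heart produced by the category birth
gives, level by level (choice), classical steady states `u_j, p_j` of `NS_{ν_j}(f)` for ONE smooth divergence-free mean-zero `f`, with
`∫|u_j|² < E` and `ε < ν_j‖∇u_j‖²`; `IsSteadyNSState` unfolds to `IsClassicalNSSolutionOn univ` on constant data and the strict budgets
are weakened to `≤`. -/
theorem steadyZerothLaw_of_categoryBirth :
    (∃ (ν : ℕ → ℝ) (m : ℕ → E³) (E ε : ℝ), (∀ j, 0 < ν j) ∧ Tendsto ν atTop (𝓝 0) ∧ 0 < ε ∧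
      ¬ IsMeagre {c : 𝒜 | ∀ j, ∃ (u : 𝕋³ → E³) (p : 𝕋³ → ℝ),
          IsSteadyNSState (ν j) F⟦c⟧ u p ∧ ∫ x, u x = m j ∧
            ∫ x, ‖u x‖ ^ 2 < E ∧ ε < ν j * gradNormSq u}) →
    (∀ (ν : ℝ) (m : E³), 0 < ν →
      Dense (interior {c : 𝒜 | ∀ (u : 𝕋³ → E³) (p : 𝕋³ → ℝ),
        IsSteadyNSState ν F⟦c⟧ u p → ∫ x, u x = m → ¬ IsLinNSEigenvalue ν u 0})) →
    (∀ c : 𝒜, IsSmooth F⟦c⟧ ∧ IsDivFree F⟦c⟧ ∧ HasZeroMean F⟦c⟧) →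
    Summit.AnomalousDissipation.AnomalousDissipation.Theses.CoherentStates.SteadyZerothLaw := by
  intro hP hB hD
  obtain ⟨f, hf, hdf, hmf, ν, E, ε, hν, hν0, hε, hH⟩ := loudNondegenerateSteadyStates_of_nonMeagre hP hB hD
  choose u p hst _hnd hE hεu using hH
  exact ⟨f, hf, hdf, hmf, ν, u, p, hν, hν0, fun j => hst j, ⟨E, fun j => (hE j).le⟩, ε, hε, fun j => (hεu j).le⟩

/-- **P → B → D → `CoherentStates.CoherentThesis` (stmt-AnomalousDissipation-0218)**, through the landed `steadyImpliesCoherent_proof`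
(steady classical states are time-periodic classical solutions whose period means are `∫|u|²` and `ν‖∇u‖²`). -/
theorem coherentThesis_of_categoryBirth :
    (∃ (ν : ℕ → ℝ) (m : ℕ → E³) (E ε : ℝ), (∀ j, 0 < ν j) ∧ Tendsto ν atTop (𝓝 0) ∧ 0 < ε ∧
      ¬ IsMeagre {c : 𝒜 | ∀ j, ∃ (u : 𝕋³ → E³) (p : 𝕋³ → ℝ),
          IsSteadyNSState (ν j) F⟦c⟧ u p ∧ ∫ x, u x = m j ∧
            ∫ x, ‖u x‖ ^ 2 < E ∧ ε < ν j * gradNormSq u}) →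
    (∀ (ν : ℝ) (m : E³), 0 < ν →
      Dense (interior {c : 𝒜 | ∀ (u : 𝕋³ → E³) (p : 𝕋³ → ℝ),
        IsSteadyNSState ν F⟦c⟧ u p → ∫ x, u x = m → ¬ IsLinNSEigenvalue ν u 0})) →
    (∀ c : 𝒜, IsSmooth F⟦c⟧ ∧ IsDivFree F⟦c⟧ ∧ HasZeroMean F⟦c⟧) →
    Summit.AnomalousDissipation.AnomalousDissipation.Theses.CoherentStates.CoherentThesis :=
  fun hP hB hD => Theorems.steadyImpliesCoherent_proof (steadyZerothLaw_of_categoryBirth hP hB hD)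

/-- **P → B → D → `AnomalousDissipation`** (the summit statement, by name, CONDITIONALLY on the open stub P and the two landed ones B, D),
through `CoherentStates.closes`.  This is the kernel-checked form of "P decides the summit" recorded in the line's status; it credits
nothing to any item. -/
theorem anomalousDissipation_of_categoryBirth :
    (∃ (ν : ℕ → ℝ) (m : ℕ → E³) (E ε : ℝ), (∀ j, 0 < ν j) ∧ Tendsto ν atTop (𝓝 0) ∧ 0 < ε ∧
      ¬ IsMeagre {c : 𝒜 | ∀ j, ∃ (u : 𝕋³ → E³) (p : 𝕋³ → ℝ),
          IsSteadyNSState (ν j) F⟦c⟧ u p ∧ ∫ x, u x = m j ∧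
            ∫ x, ‖u x‖ ^ 2 < E ∧ ε < ν j * gradNormSq u}) →
    (∀ (ν : ℝ) (m : E³), 0 < ν →
      Dense (interior {c : 𝒜 | ∀ (u : 𝕋³ → E³) (p : 𝕋³ → ℝ),
        IsSteadyNSState ν F⟦c⟧ u p → ∫ x, u x = m → ¬ IsLinNSEigenvalue ν u 0})) →
    (∀ c : 𝒜, IsSmooth F⟦c⟧ ∧ IsDivFree F⟦c⟧ ∧ HasZeroMean F⟦c⟧) →
    _root_.AnomalousDissipation :=
  fun hP hB hD =>
    Summit.AnomalousDissipation.AnomalousDissipation.Theses.CoherentStates.closes (coherentThesis_of_categoryBirth hP hB hD)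

/-- **MONOTONICITY CERTIFICATE OF THE RESHAPE: A → B → O → P** (rev 7's physics stub asks no more than rev 6's).  By the landed
`denseRobustNondegenerateLoud_of_dense` (A ∧ B ∧ O), at every level the OPEN nondegenerate-loud set `N_j` is dense in the non-empty open
`U`.  Then `U ∩ ⋂ⱼ N_j` — a subset of the loud set of P — is not meagre: the sets `N_j ∪ (closure U)ᶜ` are open and dense in `𝒜`, so
their intersection is residual; if `U ∩ ⋂ⱼ N_j` were meagre, its complement intersected with that residual set would be a residual,
hence dense (`𝒜` is Baire: `baireSpace_admissible`), set missing the non-empty open `U` — a contradiction. -/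
theorem nonMeagreLoud_of_denseLoud
    (hA : ∃ (ν : ℕ → ℝ) (m : ℕ → E³) (E ε : ℝ), (∀ j, 0 < ν j) ∧ Tendsto ν atTop (𝓝 0) ∧ 0 < ε ∧
      ∃ U : Set 𝒜, IsOpen U ∧ U.Nonempty ∧
        ∀ j, U ⊆ closure {c : 𝒜 | ∃ (u : 𝕋³ → E³) (p : 𝕋³ → ℝ),
          IsSteadyNSState (ν j) F⟦c⟧ u p ∧ ∫ x, u x = m j ∧
            ∫ x, ‖u x‖ ^ 2 < E ∧ ε < ν j * gradNormSq u})
    (hB : ∀ (ν : ℝ) (m : E³), 0 < ν →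
      Dense (interior {c : 𝒜 | ∀ (u : 𝕋³ → E³) (p : 𝕋³ → ℝ),
        IsSteadyNSState ν F⟦c⟧ u p → ∫ x, u x = m → ¬ IsLinNSEigenvalue ν u 0}))
    (hO : ∀ (ν : ℝ) (m : E³) (E ε : ℝ), 0 < ν →
      IsOpen {c : 𝒜 | ∃ (u : 𝕋³ → E³) (p : 𝕋³ → ℝ),
        IsSteadyNSState ν F⟦c⟧ u p ∧ ∫ x, u x = m ∧ ¬ IsLinNSEigenvalue ν u 0 ∧
          ∫ x, ‖u x‖ ^ 2 < E ∧ ε < ν * gradNormSq u}) :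
    ∃ (ν : ℕ → ℝ) (m : ℕ → E³) (E ε : ℝ), (∀ j, 0 < ν j) ∧ Tendsto ν atTop (𝓝 0) ∧ 0 < ε ∧
      ¬ IsMeagre {c : 𝒜 | ∀ j, ∃ (u : 𝕋³ → E³) (p : 𝕋³ → ℝ),
          IsSteadyNSState (ν j) F⟦c⟧ u p ∧ ∫ x, u x = m j ∧
            ∫ x, ‖u x‖ ^ 2 < E ∧ ε < ν j * gradNormSq u} := by
  obtain ⟨ν, m, E, ε, hν, hν0, hε, U, hUo, hUne, hU⟩ := denseRobustNondegenerateLoud_of_dense hA hB hO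
  refine ⟨ν, m, E, ε, hν, hν0, hε, ?_⟩
  haveI : BaireSpace 𝒜 := baireSpace_admissible
  -- the open nondegenerate-loud sets, dense in `U`
  set N : ℕ → Set 𝒜 := fun j => {c : 𝒜 | ∃ (u : 𝕋³ → E³) (p : 𝕋³ → ℝ),
    IsSteadyNSState (ν j) F⟦c⟧ u p ∧ ∫ x, u x = m j ∧ ¬ IsLinNSEigenvalue (ν j) u 0 ∧
      ∫ x, ‖u x‖ ^ 2 < E ∧ ε < ν j * gradNormSq u} with hN
  have hNo : ∀ j, IsOpen (N j) := fun j => hO (ν j) (m j) E ε (hν j)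
  have hUN : ∀ j, U ⊆ closure (N j) := fun j => by
    have h := hU j
    rwa [(hNo j).interior_eq] at h
  -- `N_j ∪ (closure U)ᶜ` is open and dense, hence the intersection over `j` is residual
  have hdense : ∀ j, Dense (N j ∪ (closure U)ᶜ) := fun j x => by
    by_cases hx : x ∈ closure U
    · exact closure_mono subset_union_left ((closure_minimal (hUN j) isClosed_closure) hx)
    · exact subset_closure (Or.inr hx)
  have hres : (⋂ j, (N j ∪ (closure U)ᶜ)) ∈ residual 𝒜 :=
    countable_iInter_mem.2 fun j => residual_of_dense_open ((hNo j).union isClosed_closure.isOpen_compl) (hdense j)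
  -- the loud set of P contains `U ∩ ⋂ⱼ N_j`
  intro hmeagre
  have hsub : U ∩ ⋂ j, N j ⊆ {c : 𝒜 | ∀ j, ∃ (u : 𝕋³ → E³) (p : 𝕋³ → ℝ),
      IsSteadyNSState (ν j) F⟦c⟧ u p ∧ ∫ x, u x = m j ∧
        ∫ x, ‖u x‖ ^ 2 < E ∧ ε < ν j * gradNormSq u} := by
    rintro c ⟨-, hc⟩ j
    obtain ⟨u, p, hst, hm, -, hE, hεu⟩ := mem_iInter.1 hc j
    exact ⟨u, p, hst, hm, hE, hεu⟩
  have hM : IsMeagre (U ∩ ⋂ j, N j) := hmeagre.mono hsub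
  -- a residual set missing `U`: contradiction with Baire
  have hT : Dense ((U ∩ ⋂ j, N j)ᶜ ∩ ⋂ j, (N j ∪ (closure U)ᶜ)) :=
    dense_of_mem_residual (inter_mem hM hres)
  obtain ⟨c, hcU, hcM, hcR⟩ := hT.inter_open_nonempty U hUo hUne
  apply hcM
  refine ⟨hcU, mem_iInter.2 fun j => ?_⟩
  rcases mem_iInter.1 hcR j with h | h
  · exact h
  · exact absurd (subset_closure hcU) h

end Summit.AnomalousDissipation.AnomalousDissipation.Theorems.WindLineWindyGalerkinSteadyZerothLaw

end
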